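import Mathlib.Analysis.Complex.Basic
import Mathlib.RingTheory.Norm.Basic
import Mathlib.NumberTheory.NumberField.Basic
import Literature.NumberTheory.ComplexMultiplication.TypeNorm
import Literature.AlgebraicGeometry.Liu2021.AlbaneseUnitaryShimura
import HarnessLib

/-!
# Liu 2021: CM data for a weight-one character (typed skeleton of Def. 4.5 / Prop. 4.6 (1))

Yifeng Liu, *Fourier–Jacobi cycles and arithmetic relative trace formula*, Cambridge J. Math. 9 (2021) 1–147 =
arXiv:2102.11518 [Liu2021], §4.1 "Automorphic characters and CM data".  WHAT IS REPRODUCED: Def. 4.5 (the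
reciprocity map `η'_μ`, `η_μ := η'_μ ∘ Nm_{M_μ/M'_μ}`, and the CM data `D_μ = (A_μ, i_μ, λ_μ, r_μ)` of a conjugate
symplectic automorphic character `μ` of weight one) as a TYPED SKELETON: the carriers of ONE object `D_μ ∈ 𝒜(μ)` are
the hypothesis structure `LiuCMData E` (the number fields `M_μ ⊇ M'_μ`, the reciprocity map on points, the determinant
character of `Lie_E(A_μ)`), the first bullet of Def. 4.5 (2) is the predicate `Def45_det`, and the two READINGS a
user needs to pass to complex embeddings (`LieEigenReading`, `ReflexNormReading`) are separate labelled predicates, so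
that nothing is smuggled; NOTHING IS ASSERTED.  Prop. 4.6 (1) ("`𝒜(μ)` is nonempty") is the citation that licenses
positing an inhabitant with `Def45_det` for every weight-one `μ` (`LiuCMFamily`).  PROVED: `prod_apply_eq_of_det45` —
under `Def45_det` and the two readings, the product character of the eigen-set `Θ ⊆ Hom(M_μ, ℂ)` is the type norm of
`S ⊆ Hom(M'_μ, ℂ)` composed with `N_{M_μ/M'_μ}` and, BY NAME of the tree's CM-type combinatorics `Literature.NumberTheory.ComplexMultiplication.type_eq_induced_of_prod_eq`
(multiplicative independence of embeddings), `cmType_eq_induced_of_det45`: `Θ` IS the inflation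
`{θ | θ|_{M'_μ} ∈ S}` of `S` (the type of `A_μ ⊗_{E,ι₁} ℂ` is induced from the reflex type).  Quotations AS PRINTED: held arXiv text
`paper:arxiv-2102.11518` chunks p0018 L53 – p0019 L12, p0023 L1, checked against the author's TeX (`FJcycle.tex`
ll. 1936–1987 and, for the Thm. 4.18 proof sentence, l. 2250 (proof of `th:cm_albanese` begins l. 2247)); arXiv numbering.

AS PRINTED, Def. 4.5 (p0018 L53–77): "Let `μ` be a conjugate symplectic automorphic character of weight one.  (1) We
denote by `η'_μ : Res_{M'_μ/ℚ}𝔾_m → Res_{E/ℚ}𝔾_m` the reciprocity map, and put `η_μ := η'_μ ∘ Nm_{M_μ/M'_μ} :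
Res_{M_μ/ℚ}𝔾_m → Res_{E/ℚ}𝔾_m`.  (2) We define a *CM data for `μ`* to be a quadruple `D_μ = (A_μ, i_μ, λ_μ, r_μ)`, in
which • `A_μ` is an abelian variety over `E`, • `i_μ : M_μ → End_E(A_μ)_ℚ` is a CM structure such that – for every
`x ∈ M_μ`, the determinant of the action of `i_μ(x)` on the `E`-vector space `Lie_E(A_μ)` equals `η_μ(x)`, – the
associated CM character of `A_μ` with respect to the inclusion `M_μ ↪ ℂ` coincides with `μ^{alg}`, • `λ_μ : A_μ → A_μ^∨`
is a polarization satisfying `λ ∘ i_μ(x) = i_μ(x̄)^∨ ∘ λ` for every `x ∈ M_μ`, • `r_μ : M_μ ⊗_ℚ E → H_1^{dR}(A_μ/E)` is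
an isomorphism of `M_μ ⊗_ℚ E`-modules satisfying [a trace condition on the `λ`-pairing].  (3) We denote by `𝒜(μ)` the
*category of CM data for `μ`* …".  Prop. 4.6 (p0018 L79–84; proof p0019 L1–12): "Let `μ` be as in Definition 4.5.
(1) The category `𝒜(μ)` is a nonempty and connected partially ordered set.  (2) The assignment sending `D_μ` to
`D_μ^∨` induces an equivalence `𝒜(μ)^{op} ≃ 𝒜(μ^c)` of categories."  (Non-emptiness via Casselman's theorem,
Shimura 1971 Thm 6, Lemmas 1–2, Thm 5, and Deninger 1989 (2.1), as printed in the proof.)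

NOT here: `A_μ`, `i_μ`, `λ_μ`, `r_μ` themselves (no abelian varieties at this level), the second bullet of Def. 4.5 (2)
(the CM character of `A_μ` is `μ^{alg}`), Prop. 4.6 (2), the morphisms of `𝒜(μ)`.

## References

* [Liu2021] Y. Liu, Camb. J. Math. 9 (2021) 1–147, arXiv:2102.11518 — Def. 4.3 (2), Def. 4.5, Prop. 4.6, proof of
  Thm. 4.18 (first sentence).
* [ShimuraIATAF1971], [Deninger1989] — inputs of Liu's proof of Prop. 4.6 (1) (quoted, not used).
-/

namespace Literature.AlgebraicGeometry.Liu2021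

universe u w

/-- **Carriers of one CM datum `D_μ = (A_μ, i_μ, λ_μ, r_μ) ∈ 𝒜(μ)`** ([Liu2021] Def. 4.5, p0018 L53–77) for ONE conjugate
symplectic automorphic character `μ` of weight one of the CM field `E` (any field here):
* `M` — `M_μ ⊆ ℂ`, "the subfield generated by values `μ^{alg}(x)` …, a number field containing `M'_μ`" (paragraph
  after Def. 4.3, p0018 L48);
* `M'` — `M'_μ ⊆ ℂ`, "the reflex field of `(E, Φ_μ)`, with the induced CM type `Ψ_μ`" (Def. 4.3 (2), p0018 L42),
  with the inclusion `M'_μ ⊆ M_μ` as the `Algebra M' M` structure;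
* `etaPrime` — the reciprocity map `η'_μ : Res_{M'_μ/ℚ}𝔾_m → Res_{E/ℚ}𝔾_m` (Def. 4.5 (1)) on points, a bare function
  `M' → E` (only its values on `M' ∖ {0}` are used);
* `detLie` — `x ↦` "the determinant of the action of `i_μ(x)` on the `E`-vector space `Lie_E(A_μ)`" (Def. 4.5 (2)),
  a bare function `M → E`.
The number fields are bundled (they depend on `μ`); their structure instances are re-exposed below.  A hypothesis
structure: nothing is asserted. [cite: Liu2021, Def. 4.3 (2) and Def. 4.5] -/
structure LiuCMData (E : Type u) [Field E] where
  /-- `M_μ` -/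
  M : Type u
  [instFieldM : Field M]
  [instNumberFieldM : NumberField M]
  /-- `M'_μ`, the reflex field of `(E, Φ_μ)` -/
  M' : Type u
  [instFieldM' : Field M']
  [instNumberFieldM' : NumberField M']
  /-- `M'_μ ⊆ M_μ` -/
  [instAlgebra : Algebra M' M]
  /-- `η'_μ` on points: the reciprocity map `M'_μ^× → E^×` (Def. 4.5 (1)) -/
  etaPrime : M' → E
  /-- `x ↦ det(i_μ(x) | Lie_E(A_μ))` (Def. 4.5 (2), first bullet) -/
  detLie : M → E

-- Structure-carried instances re-exposed for the bundled fields `C.M`, `C.M'` only (the number fields `M_μ ⊇ M'_μ`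
-- genuinely depend on the datum, as in Mathlib's `CategoryTheory.Bundled` pattern); they apply to no other type.
attribute [instance] LiuCMData.instFieldM LiuCMData.instNumberFieldM LiuCMData.instFieldM'
  LiuCMData.instNumberFieldM' LiuCMData.instAlgebra

namespace LiuCMData

variable {E : Type u} [Field E]

/-- **[Liu2021, Def. 4.5 (1)]**: `η_μ := η'_μ ∘ Nm_{M_μ/M'_μ}` (on points: `x ↦ η'_μ(N_{M_μ/M'_μ} x)`, `Algebra.norm M'`).
[cite: Liu2021, Def. 4.5 (1)] -/
noncomputable def eta (C : LiuCMData.{u} E) (x : C.M) : E :=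
  C.etaPrime (Algebra.norm C.M' x)

/-- Unfolding of `eta`. [cite: Liu2021, Def. 4.5 (1)] -/
theorem eta_def (C : LiuCMData.{u} E) (x : C.M) : C.eta x = C.etaPrime (Algebra.norm C.M' x) := rfl

/-- **[Liu2021, Def. 4.5 (2), first bullet]**, AS PRINTED: "for every `x ∈ M_μ`, the determinant of the action of `i_μ(x)`
on the `E`-vector space `Lie_E(A_μ)` equals `η_μ(x)`" — typed for `x ≠ 0` (the reciprocity map is a map of tori;
weaker than print, never stronger).  This is the DEFINING property of an object of `𝒜(μ)`; that such an object EXISTS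
is [Liu2021, Prop. 4.6 (1)]. [cite: Liu2021, Def. 4.5 (2)] -/
def Def45_det (C : LiuCMData.{u} E) : Prop :=
  ∀ x : C.M, x ≠ 0 → C.detLie x = C.eta x

/-- **READING (linear algebra; labelled, not print by name)**: after the base change `ι₁ : E → ℂ`,
`Lie_E(A_μ) ⊗_{E,ι₁} ℂ` is the direct sum of the eigenlines `ℂ_θ`, `θ` running over a finite SET `Θ` of embeddings
`M_μ → ℂ` (multiplicity-free because `H¹_B(A_μ ⊗_{E,ι₁} ℂ, ℚ)` is a free `M_μ`-module of rank one — [Liu2021] proof of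
Thm. 4.18, p0023 L1: "the maximal subspace of … `H¹_{B,τ'}(A_μ, ℂ)` over which `M_μ` acts via the inclusion `M_μ ↪ ℂ`
has dimension `1`"), so that `ι₁(det(i_μ(x) | Lie_E(A_μ))) = ∏_{θ ∈ Θ} θ(x)`; `Θ` is the CM type of `A_μ ⊗_{E,ι₁} ℂ`
as an `M_μ`-CM abelian variety. [folklore] -/
def LieEigenReading (C : LiuCMData.{u} E) (ι₁ : E →+* ℂ) (Θ : Finset (C.M →+* ℂ)) : Prop :=
  ∀ x : C.M, x ≠ 0 → ι₁ (C.detLie x) = ∏ θ ∈ Θ, θ x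

/-- **READING (the defining formula of the reciprocity map; labelled, not print by name)**: read through
`ι₁ : E → ℂ`, the reciprocity map `η'_μ` of the CM type `(E, Φ_μ)` is the TYPE NORM of a finite set `S` of embeddings
`M'_μ → ℂ`: `ι₁(η'_μ(y)) = ∏_{σ' ∈ S} σ'(y)` for `y ∈ M'_μ^×` (for `ι₁ = τ' ∈ Φ_μ` and Liu's inclusion `M'_μ ⊆ ℂ`,
`S = Ψ_μ`, the induced CM type of the reflex field, [Liu2021] Def. 4.3 (2)). [folklore] -/
def ReflexNormReading (C : LiuCMData.{u} E) (ι₁ : E →+* ℂ) (S : Finset (C.M' →+* ℂ)) : Prop :=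
  ∀ y : C.M', y ≠ 0 → ι₁ (C.etaPrime y) = ∏ σ' ∈ S, σ' y

/-- **Under `Def45_det` and the two readings, the product character of `Θ` is the type norm of `S` composed with
`N_{M_μ/M'_μ}`**: `∏_{θ ∈ Θ} θ(x) = ∏_{σ' ∈ S} σ'(N_{M_μ/M'_μ} x)` for `x ≠ 0` — the input of the CM-type combinatorics
that identifies `Θ` with the inflation `{θ | θ|_{M'_μ} ∈ S}` of `S`. [folklore] -/
theorem prod_apply_eq_of_det45 {C : LiuCMData.{u} E} (h : C.Def45_det) {ι₁ : E →+* ℂ} {Θ : Finset (C.M →+* ℂ)}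
    {S : Finset (C.M' →+* ℂ)} (hΘ : C.LieEigenReading ι₁ Θ) (hS : C.ReflexNormReading ι₁ S) (x : C.M)
    (hx : x ≠ 0) : ∏ θ ∈ Θ, θ x = ∏ σ' ∈ S, σ' (Algebra.norm C.M' x) := by
  haveI : IsScalarTower ℚ C.M' C.M := IsScalarTower.of_algebraMap_eq' (Subsingleton.elim _ _)
  haveI : Module.Finite C.M' C.M := Module.Finite.of_restrictScalars_finite ℚ C.M' C.M
  have hN : Algebra.norm C.M' x ≠ 0 := Algebra.norm_ne_zero_iff.mpr hx
  rw [← hΘ x hx, h x hx, eta_def, hS _ hN]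

/-- **The CM type of `A_μ ⊗_{E,ι₁} ℂ` is INDUCED (inflated) from `S`**: under [Liu2021] Def. 4.5 (2) first bullet
(`Def45_det`) and the two labelled readings, `Θ = {θ : M_μ → ℂ | θ|_{M'_μ} ∈ S}` — by
`Literature.NumberTheory.ComplexMultiplication.type_eq_induced_of_prod_eq` (multiplicative independence of field
embeddings + `∏_{σ' ∈ S} σ'(N_{M/M'} x) = ∏_{θ|_{M'} ∈ S} θ x`) applied to `prod_apply_eq_of_det45`. [folklore] -/
theorem cmType_eq_induced_of_det45 {C : LiuCMData.{u} E} [DecidableEq (C.M' →+* ℂ)] (h : C.Def45_det)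
    {ι₁ : E →+* ℂ} {Θ : Finset (C.M →+* ℂ)} {S : Finset (C.M' →+* ℂ)} (hΘ : C.LieEigenReading ι₁ Θ)
    (hS : C.ReflexNormReading ι₁ S) :
    Θ = Finset.univ.filter (fun θ : C.M →+* ℂ => θ.comp (algebraMap C.M' C.M) ∈ S) :=
  Literature.NumberTheory.ComplexMultiplication.type_eq_induced_of_prod_eq S Θ (prod_apply_eq_of_det45 h hΘ hS)

/-- Membership form: an embedding `θ : M_μ → ℂ` is an eigencharacter of `Lie_E(A_μ) ⊗_{E,ι₁} ℂ` iff its restriction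
to `M'_μ` lies in `S`. [folklore] -/
theorem mem_cmType_iff_of_det45 {C : LiuCMData.{u} E} [DecidableEq (C.M' →+* ℂ)] (h : C.Def45_det)
    {ι₁ : E →+* ℂ} {Θ : Finset (C.M →+* ℂ)} {S : Finset (C.M' →+* ℂ)} (hΘ : C.LieEigenReading ι₁ Θ)
    (hS : C.ReflexNormReading ι₁ S) (θ : C.M →+* ℂ) : θ ∈ Θ ↔ θ.comp (algebraMap C.M' C.M) ∈ S := by
  rw [cmType_eq_induced_of_det45 h hΘ hS]
  simp

end LiuCMData

/-- **A CM datum for every weight-one character** — the family form a user of `LiuAlbaneseDatum` posits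
([Liu2021] Prop. 4.6 (1): `𝒜(μ)` is nonempty for every conjugate symplectic `μ` of weight one, i.e. for every
`μ : D.Char`): `data μ` = a chosen `D_μ ∈ 𝒜(μ)` (whose `A_μ` is the class `D.Amu μ`), with Def. 4.5 (2) first bullet
at every `μ`. [cite: Liu2021, Prop. 4.6 (1)] -/
structure LiuCMFamily (E : Type u) [Field E] {Isog : Type w} (D : LiuAlbaneseDatum.{u, w} Isog) where
  /-- the chosen object `D_μ ∈ 𝒜(μ)` ([Liu2021] Prop. 4.6 (1)) -/
  data : D.Char → LiuCMData.{u} E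
  /-- [Liu2021] Def. 4.5 (2), first bullet, for the chosen object -/
  def45 : ∀ μ : D.Char, (data μ).Def45_det

namespace LiuCMFamily

/-- The product identity of `prod_apply_eq_of_det45`, per character of the family. [folklore] -/
theorem prod_apply_eq {E : Type u} [Field E] {Isog : Type w} {D : LiuAlbaneseDatum.{u, w} Isog}
    (F : LiuCMFamily E D) (μ : D.Char) {ι₁ : E →+* ℂ} {Θ : Finset ((F.data μ).M →+* ℂ)}
    {S : Finset ((F.data μ).M' →+* ℂ)} (hΘ : (F.data μ).LieEigenReading ι₁ Θ)
    (hS : (F.data μ).ReflexNormReading ι₁ S) (x : (F.data μ).M) (hx : x ≠ 0) :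
    ∏ θ ∈ Θ, θ x = ∏ σ' ∈ S, σ' (Algebra.norm (F.data μ).M' x) :=
  LiuCMData.prod_apply_eq_of_det45 (F.def45 μ) hΘ hS x hx

/-- The induced-type conclusion, per character of the family. [folklore] -/
theorem cmType_eq_induced {E : Type u} [Field E] {Isog : Type w} {D : LiuAlbaneseDatum.{u, w} Isog}
    (F : LiuCMFamily E D) (μ : D.Char) [DecidableEq ((F.data μ).M' →+* ℂ)] {ι₁ : E →+* ℂ}
    {Θ : Finset ((F.data μ).M →+* ℂ)} {S : Finset ((F.data μ).M' →+* ℂ)}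
    (hΘ : (F.data μ).LieEigenReading ι₁ Θ) (hS : (F.data μ).ReflexNormReading ι₁ S) :
    Θ = Finset.univ.filter (fun θ : (F.data μ).M →+* ℂ => θ.comp (algebraMap (F.data μ).M' (F.data μ).M) ∈ S) :=
  LiuCMData.cmType_eq_induced_of_det45 (F.def45 μ) hΘ hS

end LiuCMFamily

end Literature.AlgebraicGeometry.Liu2021
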